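import Literature.NumberTheory.ModularForms.LogLambda
import Literature.NumberTheory.ModularForms.QuasimodularPhi
import HarnessLib

/-!
# The functions `ψ₀, ψ₂, ψ₄` of CKMRV Proposition 4.3 and the system (4.7)

Cohn–Kumar–Miller–Radchenko–Viazovska, Ann. of Math. 196 (2022) = arXiv:1902.05438, §4.2,
Proposition 4.3: "The space `Ann_k(𝓘₋, 𝓟)`, i.e., the space of solutions `f ∈ 𝓟` to the system
(4.7) `f|ₖ(T − I)² = 0` and `f|ₖ(S − I) = 0`, is equal to (4.8)
`ψ₄ M_{k−4}(SL₂(ℤ)) + ψ₂ M_{k−2}(SL₂(ℤ)) + ψ₀ M_k(SL₂(ℤ))`, where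
`ψ₄ = ξ₄·𝓛 + (ξ₄|₄S)·𝓛_S`, `ψ₂ = ξ₂·𝓛 + (ξ₂|₂S)·𝓛_S`, and `ψ₀ = 1`, with
`ξ₄ = U² + W² − 2V²` and `ξ₂ = U + W`." Its proof begins: "it is straightforward to use (2.6)
and (2.11) to verify that all elements of (4.8) satisfy (4.7)".

This file vendors the DEFINITIONS `xi2`, `xi4`, `psi2`, `psi4` (`ψ₀ = 1`) and the system (4.7)
(`IsAnnMinus k g`), and PROVES that easy inclusion: `ξ₂|₂S = −(U + V)`, `ξ₄|₄S = U² + V² − 2W²`,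
`ψⱼ|ⱼS = ψⱼ`, `ψⱼ|ⱼT = ψⱼ + iπ ξⱼ` with `ξⱼ|ⱼT = ξⱼ`, hence `ψⱼ f ∈ Ann_k(𝓘₋)` for every `T`- and
`S`-invariant `f` of weight `k − j` (`psi2_mul_isAnnMinus`, `psi4_mul_isAnnMinus`, and
`isAnnMinus_of_invariant` for `ψ₀ = 1`), from the `U, V, W` table (2.6)
(`JacobiThetaGammaTwo.lean`) and the laws (2.11) of `𝓛, 𝓛_S` (`LogLambda.lean`). The reverse
inclusion (uniqueness) and the membership `ψⱼ ∈ 𝓟` (growth of `𝓛`) are not treated here.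

## References

* H. Cohn, A. Kumar, S. D. Miller, D. Radchenko, M. Viazovska, Ann. of Math. 196 (2022),
  arXiv:1902.05438, §4.2 Proposition 4.3, (4.7)–(4.8). [CohnEtAl2019]
-/

noncomputable section

open Complex hiding I
open Filter Topology ModularForm SlashInvariantForm
open UpperHalfPlane hiding I
open Complex (I)
open scoped Real MatrixGroups ModularForm Manifold

namespace Literature.NumberTheory.ModularForms

/-! ## `ξ₂ = U + W`, `ξ₄ = U² + W² − 2V²` and their images under `S` and `T` -/

/-- **`ξ₂ = U + W`** (CKMRV Prop. 4.3). [cite: CohnEtAl2019, §4.2 Proposition 4.3] -/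
def xi2 : ℍ → ℂ := thetaU + thetaW

/-- **`ξ₄ = U² + W² − 2V²`** (CKMRV Prop. 4.3). [cite: CohnEtAl2019, §4.2 Proposition 4.3] -/
def xi4 : ℍ → ℂ := thetaU * thetaU + thetaW * thetaW - (2 : ℂ) • (thetaV * thetaV)

/-- `ξ₂|₂S = −(U + V)`. [cite: CohnEtAl2019, §4.2 Proposition 4.3] -/
def xi2S : ℍ → ℂ := -(thetaU + thetaV)

/-- `ξ₄|₄S = U² + V² − 2W²`. [cite: CohnEtAl2019, §4.2 Proposition 4.3] -/
def xi4S : ℍ → ℂ := thetaU * thetaU + thetaV * thetaV - (2 : ℂ) • (thetaW * thetaW)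

/-- `ξ₂|₂T = ξ₂`. [folklore] -/
theorem xi2_slash_T : xi2 ∣[(2 : ℤ)] ModularGroup.T = xi2 := by
  rw [xi2, SlashAction.add_slash, thetaU_slash_T, thetaW_slash_T, add_comm]

/-- `ξ₂|₂S = −(U + V)`. [folklore] -/
theorem xi2_slash_S : xi2 ∣[(2 : ℤ)] ModularGroup.S = xi2S := by
  rw [xi2, xi2S, SlashAction.add_slash, thetaU_slash_S, thetaW_slash_S]; abel

/-- `(ξ₂|₂S)|₂T = V − W`. [folklore] -/
theorem xi2S_slash_T : xi2S ∣[(2 : ℤ)] ModularGroup.T = thetaV - thetaW := by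
  rw [xi2S, SlashAction.neg_slash, SlashAction.add_slash, thetaU_slash_T, thetaV_slash_T]; abel

/-- `(ξ₂|₂S)|₂S = ξ₂`. [folklore] -/
theorem xi2S_slash_S : xi2S ∣[(2 : ℤ)] ModularGroup.S = xi2 := by
  rw [xi2S, xi2, SlashAction.neg_slash, SlashAction.add_slash, thetaU_slash_S, thetaV_slash_S]; abel

/-- `ξ₄|₄T = ξ₄`. [folklore] -/
theorem xi4_slash_T : xi4 ∣[(4 : ℤ)] ModularGroup.T = xi4 := by
  rw [xi4, show (4 : ℤ) = 2 + 2 by norm_num, sub_eq_add_neg, SlashAction.add_slash,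
    SlashAction.add_slash, SlashAction.neg_slash, SL_smul_slash, mul_slash_SL2, mul_slash_SL2,
    mul_slash_SL2, thetaU_slash_T, thetaV_slash_T, thetaW_slash_T]
  ring

/-- `ξ₄|₄S = U² + V² − 2W²`. [folklore] -/
theorem xi4_slash_S : xi4 ∣[(4 : ℤ)] ModularGroup.S = xi4S := by
  rw [xi4, xi4S, show (4 : ℤ) = 2 + 2 by norm_num, sub_eq_add_neg, SlashAction.add_slash,
    SlashAction.add_slash, SlashAction.neg_slash, SL_smul_slash, mul_slash_SL2, mul_slash_SL2,
    mul_slash_SL2, thetaU_slash_S, thetaV_slash_S, thetaW_slash_S]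
  ring

/-- `(ξ₄|₄S)|₄T = V² + W² − 2U²`. [folklore] -/
theorem xi4S_slash_T :
    xi4S ∣[(4 : ℤ)] ModularGroup.T = thetaV * thetaV + thetaW * thetaW - (2 : ℂ) • (thetaU * thetaU) := by
  rw [xi4S, show (4 : ℤ) = 2 + 2 by norm_num, sub_eq_add_neg, SlashAction.add_slash,
    SlashAction.add_slash, SlashAction.neg_slash, SL_smul_slash, mul_slash_SL2, mul_slash_SL2,
    mul_slash_SL2, thetaU_slash_T, thetaV_slash_T, thetaW_slash_T]
  ring

/-- `(ξ₄|₄S)|₄S = ξ₄`. [folklore] -/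
theorem xi4S_slash_S : xi4S ∣[(4 : ℤ)] ModularGroup.S = xi4 := by
  rw [xi4S, xi4, show (4 : ℤ) = 2 + 2 by norm_num, sub_eq_add_neg, SlashAction.add_slash,
    SlashAction.add_slash, SlashAction.neg_slash, SL_smul_slash, mul_slash_SL2, mul_slash_SL2,
    mul_slash_SL2, thetaU_slash_S, thetaV_slash_S, thetaW_slash_S]
  ring

/-! ## `ψ₂`, `ψ₄` -/

/-- **`ψ₂ = ξ₂·𝓛 + (ξ₂|₂S)·𝓛_S`** (CKMRV Prop. 4.3). [cite: CohnEtAl2019, §4.2 Proposition 4.3] -/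
def psi2 : ℍ → ℂ := xi2 * logLambda + xi2S * logLambdaS

/-- **`ψ₄ = ξ₄·𝓛 + (ξ₄|₄S)·𝓛_S`** (CKMRV Prop. 4.3). [cite: CohnEtAl2019, §4.2 Proposition 4.3] -/
def psi4 : ℍ → ℂ := xi4 * logLambda + xi4S * logLambdaS

/-- `ψ₂|₂S = ψ₂`. [cite: CohnEtAl2019, §4.2 Proposition 4.3] -/
theorem psi2_slash_S : psi2 ∣[(2 : ℤ)] ModularGroup.S = psi2 := by
  rw [psi2, show (2 : ℤ) = 2 + 0 by norm_num, SlashAction.add_slash, mul_slash_SL2, mul_slash_SL2,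
    xi2_slash_S, xi2S_slash_S, logLambda_slash_S, logLambdaS_slash_S]
  ring

/-- `ψ₂|₂T = ψ₂ + iπ ξ₂`. [cite: CohnEtAl2019, §4.2 Proposition 4.3] -/
theorem psi2_slash_T : psi2 ∣[(2 : ℤ)] ModularGroup.T = psi2 + (π * I) • xi2 := by
  rw [psi2, show (2 : ℤ) = 2 + 0 by norm_num, SlashAction.add_slash, mul_slash_SL2, mul_slash_SL2,
    xi2_slash_T, xi2S_slash_T, logLambda_slash_T, logLambdaS_slash_T]
  funext τ
  simp only [Pi.add_apply, Pi.mul_apply, Pi.sub_apply, Pi.neg_apply, Pi.smul_apply, smul_eq_mul, xi2,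
    xi2S]
  ring

/-- `ψ₄|₄S = ψ₄`. [cite: CohnEtAl2019, §4.2 Proposition 4.3] -/
theorem psi4_slash_S : psi4 ∣[(4 : ℤ)] ModularGroup.S = psi4 := by
  rw [psi4, show (4 : ℤ) = 4 + 0 by norm_num, SlashAction.add_slash, mul_slash_SL2, mul_slash_SL2,
    xi4_slash_S, xi4S_slash_S, logLambda_slash_S, logLambdaS_slash_S]
  ring

/-- `ψ₄|₄T = ψ₄ + iπ ξ₄`. [cite: CohnEtAl2019, §4.2 Proposition 4.3] -/
theorem psi4_slash_T : psi4 ∣[(4 : ℤ)] ModularGroup.T = psi4 + (π * I) • xi4 := by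
  rw [psi4, show (4 : ℤ) = 4 + 0 by norm_num, SlashAction.add_slash, mul_slash_SL2, mul_slash_SL2,
    xi4_slash_T, xi4S_slash_T, logLambda_slash_T, logLambdaS_slash_T]
  funext τ
  simp only [Pi.add_apply, Pi.mul_apply, Pi.sub_apply, Pi.neg_apply, Pi.smul_apply, smul_eq_mul, xi4,
    xi4S]
  ring

/-! ## The system (4.7) and the easy inclusion of Proposition 4.3 -/

/-- **The system (4.7)**: `g|ₖ(T − I)² = 0` and `g|ₖ(S − I) = 0`, i.e. `g` is annihilated by the
right ideal `𝓘₋ = (S − I)·R + (T − I)²·R` under the weight-`k` action (membership in `𝓟` is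
kept separate). [cite: CohnEtAl2019, §4.2 (4.7)] -/
structure IsAnnMinus (k : ℤ) (g : ℍ → ℂ) : Prop where
  T_sq : (g ∣[k] ModularGroup.T) ∣[k] ModularGroup.T - (2 : ℂ) • g ∣[k] ModularGroup.T + g = 0
  S_sub : g ∣[k] ModularGroup.S = g

/-- **`ψ₀ = 1`**: a `T`- and `S`-invariant `f` of weight `k` (e.g. `f ∈ M_k(SL₂(ℤ))`) solves
(4.7). [cite: CohnEtAl2019, §4.2 Proposition 4.3] -/
theorem isAnnMinus_of_invariant {k : ℤ} {f : ℍ → ℂ} (hT : f ∣[k] ModularGroup.T = f)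
    (hS : f ∣[k] ModularGroup.S = f) : IsAnnMinus k f :=
  ⟨by rw [hT, hT, two_smul]; abel, hS⟩

/-- The mechanism: if `ψ|ⱼS = ψ`, `ψ|ⱼT = ψ + c ξ` with `ξ|ⱼT = ξ`, and `f` is `T`- and
`S`-invariant of weight `k − j`, then `ψ f` solves (4.7) in weight `k`. [folklore] -/
theorem IsAnnMinus.of_mul {j k : ℤ} {ψ ξ f : ℍ → ℂ} {c : ℂ} (hψS : ψ ∣[j] ModularGroup.S = ψ)
    (hψT : ψ ∣[j] ModularGroup.T = ψ + c • ξ) (hξT : ξ ∣[j] ModularGroup.T = ξ)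
    (hfT : f ∣[k - j] ModularGroup.T = f) (hfS : f ∣[k - j] ModularGroup.S = f) :
    IsAnnMinus k (ψ * f) := by
  have hk : k = j + (k - j) := by ring
  have hT1 : (ψ * f) ∣[k] ModularGroup.T = ψ * f + (c • ξ) * f := by
    rw [hk, mul_slash_SL2, hψT, hfT, add_mul]
  have hT2 : ((c • ξ) * f) ∣[k] ModularGroup.T = (c • ξ) * f := by
    rw [hk, mul_slash_SL2, SL_smul_slash, hξT, hfT]
  refine ⟨T_sq_of_slash_T_eq_add hT1 hT2, ?_⟩
  rw [hk, mul_slash_SL2, hψS, hfS]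

/-- **`ψ₂ f ∈ Ann_k(𝓘₋)`** for `f` invariant of weight `k − 2` under `T` and `S` (e.g.
`f ∈ M_{k−2}(SL₂(ℤ))`). [cite: CohnEtAl2019, §4.2 Proposition 4.3] -/
theorem psi2_mul_isAnnMinus {k : ℤ} {f : ℍ → ℂ} (hT : f ∣[k - 2] ModularGroup.T = f)
    (hS : f ∣[k - 2] ModularGroup.S = f) : IsAnnMinus k (psi2 * f) :=
  IsAnnMinus.of_mul psi2_slash_S psi2_slash_T xi2_slash_T hT hS

/-- **`ψ₄ f ∈ Ann_k(𝓘₋)`** for `f` invariant of weight `k − 4` under `T` and `S` (e.g.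
`f ∈ M_{k−4}(SL₂(ℤ))`). [cite: CohnEtAl2019, §4.2 Proposition 4.3] -/
theorem psi4_mul_isAnnMinus {k : ℤ} {f : ℍ → ℂ} (hT : f ∣[k - 4] ModularGroup.T = f)
    (hS : f ∣[k - 4] ModularGroup.S = f) : IsAnnMinus k (psi4 * f) :=
  IsAnnMinus.of_mul psi4_slash_S psi4_slash_T xi4_slash_T hT hS

/-- Bundled version: `ψ₂ f` for `f ∈ M_{k−2}(SL₂(ℤ))`. [cite: CohnEtAl2019, §4.2 Proposition 4.3] -/
theorem psi2_mul_isAnnMinus_of_modularForm {k : ℤ} (f : ModularForm 𝒮ℒ (k - 2)) :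
    IsAnnMinus k (psi2 * ⇑f) :=
  psi2_mul_isAnnMinus (f.slash_action_eq' _ ⟨ModularGroup.T, rfl⟩)
    (f.slash_action_eq' _ ⟨ModularGroup.S, rfl⟩)

/-- Bundled version: `ψ₄ f` for `f ∈ M_{k−4}(SL₂(ℤ))`. [cite: CohnEtAl2019, §4.2 Proposition 4.3] -/
theorem psi4_mul_isAnnMinus_of_modularForm {k : ℤ} (f : ModularForm 𝒮ℒ (k - 4)) :
    IsAnnMinus k (psi4 * ⇑f) :=
  psi4_mul_isAnnMinus (f.slash_action_eq' _ ⟨ModularGroup.T, rfl⟩)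
    (f.slash_action_eq' _ ⟨ModularGroup.S, rfl⟩)

/-- Bundled version: `ψ₀ f = f` for `f ∈ M_k(SL₂(ℤ))`. [cite: CohnEtAl2019, §4.2 Proposition 4.3] -/
theorem isAnnMinus_of_modularForm {k : ℤ} (f : ModularForm 𝒮ℒ k) : IsAnnMinus k ⇑f :=
  isAnnMinus_of_invariant (f.slash_action_eq' _ ⟨ModularGroup.T, rfl⟩)
    (f.slash_action_eq' _ ⟨ModularGroup.S, rfl⟩)

/-- `Ann_k(𝓘₋)` is closed under addition. [folklore] -/
theorem IsAnnMinus.add {k : ℤ} {g h : ℍ → ℂ} (hg : IsAnnMinus k g) (hh : IsAnnMinus k h) :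
    IsAnnMinus k (g + h) := by
  refine ⟨?_, ?_⟩
  · have := congrArg₂ (· + ·) hg.T_sq hh.T_sq
    simp only [add_zero] at this
    rw [← this, SlashAction.add_slash, SlashAction.add_slash, smul_add]
    abel
  · rw [SlashAction.add_slash, hg.S_sub, hh.S_sub]

/-- `Ann_k(𝓘₋)` is closed under scalars. [folklore] -/
theorem IsAnnMinus.smul {k : ℤ} {g : ℍ → ℂ} (hg : IsAnnMinus k g) (c : ℂ) : IsAnnMinus k (c • g) := by
  refine ⟨?_, ?_⟩
  · have := congrArg (c • ·) hg.T_sq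
    simp only [smul_zero] at this
    rw [← this, SL_smul_slash, SL_smul_slash, smul_add, smul_sub, smul_comm c (2 : ℂ)]
  · rw [SL_smul_slash, hg.S_sub]

/-- `ψ₂`, `ψ₄` are holomorphic. [folklore] -/
theorem mdifferentiable_psi :
    MDiff psi2 ∧ MDiff psi4 := by
  have hU := mdifferentiable_thetaU
  have hV := mdifferentiable_thetaV
  have hW := mdifferentiable_thetaW
  have hL := mdifferentiable_logLambda
  have hLS := mdifferentiable_logLambdaS
  refine ⟨?_, ?_⟩
  · exact ((hU.add hW).mul hL).add ((hU.add hV).neg.mul hLS)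
  · refine ((((hU.mul hU).add (hW.mul hW)).sub ((hV.mul hV).const_smul (2 : ℂ))).mul hL).add
      ((((hU.mul hU).add (hV.mul hV)).sub ((hW.mul hW).const_smul (2 : ℂ))).mul hLS)

end Literature.NumberTheory.ModularForms
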